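import Mathlib
import HarnessLib

/-!
# ValiantsHypothesis / LacunarySymmetroid — crux `MatrixDescartes` (stmt-ValiantsHypothesis-18050, V1),
# line `Cruxes/MatrixDescartes/Lines/osculation_law.lean` («osculation-law»): MONOMIAL COUNTS for the cusp curve

Support bookkeeping for the `(2,0)` splitting of the `m = 2` rung: if the exponents of a `K`-nomial pencil lie in
a finite set `E ⊆ ℕ`, then `τ = tr G` is supported in `E`, `δ = det G` in `E + E`, the operator `θ = X·d/dX` does
not enlarge supports, and products add supports (sumsets, `open Pointwise`).  Consequently the remainder polynomials
`A`, `B` of `…OsculationLawTwoKCusp` (explicit polynomials in `τ, δ, θτ, θδ, θ²τ, θ²δ`, every monomial of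
`E`-weight `5`, resp. `6`) are supported in `5 • E`, resp. `6 • E`, and `N = B² − τAB + δA²` in `12 • E`; and
`|n • E| ≤ |E|^n`.  (The monomial-by-monomial bookkeeping below was generated mechanically from the same exact
division that produced `A` and `B`, and is checked here by the kernel.)

Honest framing: arithmetic bookkeeping for a located rung of an UNREGISTERED V1 law line; nothing here bears on
`OsculationLaw`, `MatrixDescartes`, Conjecture B or `VP ≠ VNP`.  No definitions, no named facts; Mathlib only.
-/

-- `Summit.ValiantsHypothesis.ValiantsHypothesis.…` is the tree's mandated single-conjunct layout (Sub = Summit).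
set_option linter.dupNamespace false

noncomputable section

namespace Summit.ValiantsHypothesis.ValiantsHypothesis.Theorems.LacunarySymmetroidMatrixDescartes

open Polynomial
open scoped BigOperators Pointwise

namespace OsculationCusp

/-! ### Supports and sumsets -/

/-- `supp(p·q) ⊆ supp p + supp q`. [folklore] -/
theorem support_mul_subset_add' (p q : ℝ[X]) : (p * q).support ⊆ p.support + q.support := by
  intro n hn
  rw [mem_support_iff, coeff_mul] at hn
  obtain ⟨x, hx, hne⟩ := Finset.exists_ne_zero_of_sum_ne_zero hn
  rw [Finset.HasAntidiagonal.mem_antidiagonal] at hx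
  exact Finset.mem_add.2 ⟨x.1, mem_support_iff.2 (left_ne_zero_of_mul hne), x.2,
    mem_support_iff.2 (right_ne_zero_of_mul hne), hx⟩

/-- Products add the sumset weights. [folklore] -/
theorem supp_mul {E : Finset ℕ} {p q : ℝ[X]} {m n : ℕ} (hp : p.support ⊆ m • E) (hq : q.support ⊆ n • E) :
    (p * q).support ⊆ (m + n) • E :=
  (support_mul_subset_add' p q).trans (by rw [add_nsmul]; exact Finset.add_subset_add hp hq)

/-- Powers multiply the sumset weight. [folklore] -/
theorem supp_pow {E : Finset ℕ} {p : ℝ[X]} {m : ℕ} (hp : p.support ⊆ m • E) :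
    ∀ k : ℕ, 1 ≤ k → (p ^ k).support ⊆ (k * m) • E
  | 0, h => absurd h (by norm_num)
  | 1, _ => by rw [pow_one, one_mul]; exact hp
  | (k + 2), _ => by
      rw [pow_succ, Nat.succ_mul]
      exact supp_mul (supp_pow hp (k + 1) (by omega)) hp

/-- Sums stay inside a common support set. [folklore] -/
theorem supp_add {S : Finset ℕ} {p q : ℝ[X]} (hp : p.support ⊆ S) (hq : q.support ⊆ S) :
    (p + q).support ⊆ S :=
  support_add.trans (Finset.union_subset hp hq)

/-- Differences stay inside a common support set. [folklore] -/
theorem supp_sub {S : Finset ℕ} {p q : ℝ[X]} (hp : p.support ⊆ S) (hq : q.support ⊆ S) :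
    (p - q).support ⊆ S := by
  rw [sub_eq_add_neg]
  exact supp_add hp (by rwa [support_neg])

/-- Numerals do not enlarge the support. [folklore] -/
theorem supp_ofNat_mul {S : Finset ℕ} {p : ℝ[X]} (n : ℕ) [n.AtLeastTwo] (hp : p.support ⊆ S) :
    ((OfNat.ofNat n : ℝ[X]) * p).support ⊆ S := by
  rw [← map_ofNat C n, C_mul']
  exact (support_smul _ _).trans hp

/-- `θ = X·d/dX` does not enlarge the support. [folklore] -/
theorem supp_theta {S : Finset ℕ} {p : ℝ[X]} (hp : p.support ⊆ S) : (X * derivative p).support ⊆ S := by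
  refine Finset.Subset.trans ?_ hp
  intro n hn
  rw [mem_support_iff] at hn ⊢
  cases n with
  | zero => simp at hn
  | succ n =>
    rw [coeff_X_mul, coeff_derivative] at hn
    intro h
    apply hn
    rw [h, zero_mul]

/-- Re-reading the sumset weight. [folklore] -/
theorem supp_cast {E : Finset ℕ} {p : ℝ[X]} {m n : ℕ} (hp : p.support ⊆ m • E) (h : m = n) :
    p.support ⊆ n • E := h ▸ hp

/-- `|n • E| ≤ |E|^n`. [folklore] -/
theorem card_nsmul_le (E : Finset ℕ) : ∀ n : ℕ, (n • E).card ≤ E.card ^ n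
  | 0 => by simp
  | (n + 1) => by
      rw [succ_nsmul, pow_succ]
      exact Finset.card_add_le.trans (Nat.mul_le_mul (card_nsmul_le E n) le_rfl)

/-- Monomial count from a sumset bound. [folklore] -/
theorem card_support_le_of_subset_nsmul {E : Finset ℕ} {p : ℝ[X]} {n : ℕ} (hp : p.support ⊆ n • E) :
    p.support.card ≤ E.card ^ n :=
  (Finset.card_le_card hp).trans (card_nsmul_le E n)

/-! ### The remainder polynomials `A`, `B`, `N` of the cusp curve -/

/-- `supp A ⊆ 5 • E` (every monomial of `A` has `E`-weight `5`). [folklore] -/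
theorem supp_A (τ δ : ℝ[X]) (E : Finset ℕ) (hτ : τ.support ⊆ 1 • E) (hδ : δ.support ⊆ 2 • E) :
    (τ ^ 4 * (X * derivative (X * derivative τ)) - τ ^ 3 * (X * derivative τ) ^ 2 - τ ^ 3 * (X * derivative (X * derivative δ)) - 5 * τ ^ 2 * δ * (X * derivative (X * derivative τ)) + 4 * τ ^ 2 * (X * derivative τ) * (X * derivative δ) + τ * δ * (X * derivative τ) ^ 2 + 4 * τ * δ * (X * derivative (X * derivative δ)) - 3 * τ * (X * derivative δ) ^ 2 + 4 * δ ^ 2 * (X * derivative (X * derivative τ)) - 4 * δ * (X * derivative τ) * (X * derivative δ)).support ⊆ 5 • E := by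
  have hτ1 : (X * derivative τ).support ⊆ 1 • E := supp_theta hτ
  have hτ2 : (X * derivative (X * derivative τ)).support ⊆ 1 • E := supp_theta hτ1
  have hδ1 : (X * derivative δ).support ⊆ 2 • E := supp_theta hδ
  have hδ2 : (X * derivative (X * derivative δ)).support ⊆ 2 • E := supp_theta hδ1
  exact (supp_sub (supp_add (supp_sub (supp_add (supp_add (supp_add (supp_sub (supp_sub (supp_sub (supp_cast (supp_mul (supp_pow hτ 4 (by norm_num)) hτ2) (by norm_num)) (supp_cast (supp_mul (supp_pow hτ 3 (by norm_num)) (supp_pow hτ1 2 (by norm_num))) (by norm_num))) (supp_cast (supp_mul (supp_pow hτ 3 (by norm_num)) hδ2) (by norm_num))) (supp_cast (supp_mul (supp_mul (supp_ofNat_mul 5 (supp_pow hτ 2 (by norm_num))) hδ) hτ2) (by norm_num))) (supp_cast (supp_mul (supp_mul (supp_ofNat_mul 4 (supp_pow hτ 2 (by norm_num))) hτ1) hδ1) (by norm_num))) (supp_cast (supp_mul (supp_mul hτ hδ) (supp_pow hτ1 2 (by norm_num))) (by norm_num))) (supp_cast (supp_mul (supp_mul (supp_ofNat_mul 4 hτ)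 hδ) hδ2) (by norm_num))) (supp_cast (supp_mul (supp_ofNat_mul 3 hτ) (supp_pow hδ1 2 (by norm_num))) (by norm_num))) (supp_cast (supp_mul (supp_ofNat_mul 4 (supp_pow hδ 2 (by norm_num))) hτ2) (by norm_num))) (supp_cast (supp_mul (supp_mul (supp_ofNat_mul 4 hδ) hτ1) hδ1) (by norm_num)))

/-- `supp B ⊆ 6 • E` (every monomial of `B` has `E`-weight `6`). [folklore] -/
theorem supp_B (τ δ : ℝ[X]) (E : Finset ℕ) (hτ : τ.support ⊆ 1 • E) (hδ : δ.support ⊆ 2 • E) :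
    (τ ^ 3 * δ * (X * derivative (X * derivative τ)) - τ ^ 2 * δ * (X * derivative τ) ^ 2 - τ ^ 2 * δ * (X * derivative (X * derivative δ)) - 4 * τ * δ ^ 2 * (X * derivative (X * derivative τ)) + 4 * τ * δ * (X * derivative τ) * (X * derivative δ) + 4 * δ ^ 2 * (X * derivative (X * derivative δ)) - 4 * δ * (X * derivative δ) ^ 2).support ⊆ 6 • E := by
  have hτ1 : (X * derivative τ).support ⊆ 1 • E := supp_theta hτ
  have hτ2 : (X * derivative (X * derivative τ)).support ⊆ 1 • E := supp_theta hτ1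
  have hδ1 : (X * derivative δ).support ⊆ 2 • E := supp_theta hδ
  have hδ2 : (X * derivative (X * derivative δ)).support ⊆ 2 • E := supp_theta hδ1
  exact (supp_sub (supp_add (supp_add (supp_sub (supp_sub (supp_sub (supp_cast (supp_mul (supp_mul (supp_pow hτ 3 (by norm_num)) hδ) hτ2) (by norm_num)) (supp_cast (supp_mul (supp_mul (supp_pow hτ 2 (by norm_num)) hδ) (supp_pow hτ1 2 (by norm_num))) (by norm_num))) (supp_cast (supp_mul (supp_mul (supp_pow hτ 2 (by norm_num)) hδ) hδ2) (by norm_num))) (supp_cast (supp_mul (supp_mul (supp_ofNat_mul 4 hτ) (supp_pow hδ 2 (by norm_num))) hτ2) (by norm_num))) (supp_cast (supp_mul (supp_mul (supp_mul (supp_ofNat_mul 4 hτ) hδ) hτ1) hδ1) (by norm_num))) (supp_cast (supp_mul (supp_ofNat_mul 4 (supp_pow hδ 2 (by norm_num))) hδ2) (by norm_num))) (supp_cast (supp_mul (supp_ofNat_mul 4 hδ) (supp_pow hδ1 2 (by norm_num))) (by norm_num)))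

/-- `supp N ⊆ 12 • E` for `N = B² − τ·A·B + δ·A²`. [folklore] -/
theorem supp_N (τ δ : ℝ[X]) (E : Finset ℕ) (hτ : τ.support ⊆ 1 • E) (hδ : δ.support ⊆ 2 • E) :
    ((τ ^ 3 * δ * (X * derivative (X * derivative τ)) - τ ^ 2 * δ * (X * derivative τ) ^ 2 - τ ^ 2 * δ * (X * derivative (X * derivative δ)) - 4 * τ * δ ^ 2 * (X * derivative (X * derivative τ)) + 4 * τ * δ * (X * derivative τ) * (X * derivative δ) + 4 * δ ^ 2 * (X * derivative (X * derivative δ)) - 4 * δ * (X * derivative δ) ^ 2) ^ 2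
      - τ * (τ ^ 4 * (X * derivative (X * derivative τ)) - τ ^ 3 * (X * derivative τ) ^ 2 - τ ^ 3 * (X * derivative (X * derivative δ)) - 5 * τ ^ 2 * δ * (X * derivative (X * derivative τ)) + 4 * τ ^ 2 * (X * derivative τ) * (X * derivative δ) + τ * δ * (X * derivative τ) ^ 2 + 4 * τ * δ * (X * derivative (X * derivative δ)) - 3 * τ * (X * derivative δ) ^ 2 + 4 * δ ^ 2 * (X * derivative (X * derivative τ)) - 4 * δ * (X * derivative τ) * (X * derivative δ)) * (τ ^ 3 * δ * (X * derivative (X * derivative τ)) - τ ^ 2 * δ * (X * derivative τ) ^ 2 - τ ^ 2 * δ * (X * derivative (X * derivative δ)) - 4 * τ * δ ^ 2 * (X * derivative (X * derivative τ)) + 4 * τ * δ * (X * derivative τ) * (X * derivative δ) + 4 * δ ^ 2 * (X * derivative (X * derivative δ)) - 4 * δ * (X * derivative δ) ^ 2)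
      + δ * (τ ^ 4 * (X * derivative (X * derivative τ)) - τ ^ 3 * (X * derivative τ) ^ 2 - τ ^ 3 * (X * derivative (X * derivative δ)) - 5 * τ ^ 2 * δ * (X * derivative (X * derivative τ)) + 4 * τ ^ 2 * (X * derivative τ) * (X * derivative δ) + τ * δ * (X * derivative τ) ^ 2 + 4 * τ * δ * (X * derivative (X * derivative δ)) - 3 * τ * (X * derivative δ) ^ 2 + 4 * δ ^ 2 * (X * derivative (X * derivative τ)) - 4 * δ * (X * derivative τ) * (X * derivative δ)) ^ 2).support ⊆ 12 • E := by
  have hA := supp_A τ δ E hτ hδ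
  have hB := supp_B τ δ E hτ hδ
  exact supp_add (supp_sub (supp_cast (supp_pow hB 2 (by norm_num)) (by norm_num))
    (supp_cast (supp_mul (supp_mul hτ hA) hB) (by norm_num)))
    (supp_cast (supp_mul hδ (supp_pow hA 2 (by norm_num))) (by norm_num))

end OsculationCusp

end Summit.ValiantsHypothesis.ValiantsHypothesis.Theorems.LacunarySymmetroidMatrixDescartes
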